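import Literature.Computability.AlgebraicComplexity.BI17MinimalDegreeTableExtension
import HarnessLib

/-!
# `e(23) = 138 ⟺ k_13(6) > 0`: the second odd anomaly of the minimal-degree table, reduced to one atom (theorem-only)

Bürgisser–Ikenmeyer 2017 §5, Ex. 5.6 / Problem 5.19 [BurgisserIkenmeyer2017]: `e(m)` is the minimal
degree of a nonzero `SL_m³`-invariant not vanishing on generic tensors of format `m × m × m`
(`genericTensorMinimalDegree`). Below an ODD perfect square `δ²` the value `m = δ² − 2` is anomalous
(`k_2(δ) = 0` for odd `δ`, BI Rem. 5.4): BI's table has `e(7) = 28 = 7·4`, and the tree has the lower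
bound `138 ≤ e(23)` (`le_genericTensorMinimalDegree_sq_sub_two_of_odd`, `δ = 5`). This file pins the
remaining question to ONE rectangular Kronecker coefficient: **`e(23) = 138 ⟺ k_23(6) > 0 ⟺ k_13(6) > 0`**
(complement symmetry `13 + 23 = 6²`, BI eq. (5.2) / `kronRect_eq_kronRect_sq_sub`), together with the
unconditional dichotomy `e(23) = 138 ∨ 161 ≤ e(23)`.

Status of the atom (updated 2026-08-27, cell `val-lit`, seat t04 g9): **`k_13(6) > 0` IS NOW A TREE THEOREM** —
`kronRect_thirteen_six_pos` in `AC/KronRectThirteenSix.lean` (which imports this file and derives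
`genericTensorMinimalDegree_twentyThree : e(23) = 138` from `genericTensorMinimalDegree_twentyThree_iff`
below), by a kernel-checked memoised block-sign design certificate (engine `AC/KronRectDesignDAG.lean`;
design `C_0 ⊔ C_1 ⊔ D ⊆ [6]³` with `C_r = {x + y + 2z ≡ r (mod 6)}`, 541 diagonals, normalised signed
resolution count `−414 ≠ 0`, Amanov–Yeliussizov 2022 Thm. 8.4 (ii), Cor. 8.5). History: the atom is
irreducible for the semigroup tools (`gcd(13,6) = 1`; `k_13(2) = k_13(3) = 0`) and outside the
Latin-rectangle road (`13 > 6`); seat t04 g8 first verified it numerically (an annealed magic set with signed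
exact-cover sum `−1771` over `579 413` resolutions, evidence file `t04g8-k13of6-design-v1s100.txt` in the
cell), whose resolution TREE was too large for the kernel; the memoised (DAG) evaluator made a structured
design feasible. In print only `138 ≤ e(23)` is proved and equality is conjectured (AY 2022 §1, after
Thm. 1.1). Nothing here bears on VP versus VNP.

## References

* [BurgisserIkenmeyer2017] P. Bürgisser, C. Ikenmeyer, *Fundamental invariants of orbit closures*,
  J. Algebra 477 (2017), §5 eq. (5.2), Rem. 5.4, Ex. 5.6, Problem 5.19.
* [AmanovYeliussizov2022] A. Amanov, D. Yeliussizov, *Fundamental invariants of tensors, Latin hypercubes,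
  and rectangular Kronecker coefficients*, arXiv:2202.11059, Thm. 8.4, Cor. 8.5, Rem. 8.10.

## Mathlib and tree

Tree: `kronRect`, `genericTensorMinimalDegree`, `genericTensorDegreeMonoid_eq_kronRect`,
`kronRect_sq_sub_pos`, `kronRect_eq_kronRect_sq_sub`, `genericTensorMinimalDegree_le_of_kronRect_pos`,
`le_genericTensorMinimalDegree_sq_sub_two_of_odd`, `le_genericTensorMinimalDegree_of_forall_eq_zero`,
`kronRect_eq_zero_of_sq_lt`, `kronRect_sq_sub_two_eq_zero_of_odd`, `kronRect_self_pos`.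
Mathlib: `Nat.sInf_mem`, `Nat.sInf_le`.
-/

noncomputable section

namespace Literature.Computability.AlgebraicComplexity

/-- Complement symmetry at `6² = 13 + 23`: `k_23(6) > 0 ⟺ k_13(6) > 0`.
[cite: BurgisserIkenmeyer2017, §5 eq. (5.2)] -/
theorem kronRect_twentyThree_six_pos_iff : 0 < kronRect ℂ 23 6 ↔ 0 < kronRect ℂ 13 6 :=
  ⟨fun h => kronRect_sq_sub_pos (δ := 6) (j := 23) (by norm_num) h,
   fun h => kronRect_sq_sub_pos (δ := 6) (j := 13) (by norm_num) h⟩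

/-- **`k_13(6) > 0 ⟹ e(23) = 138 = 23·6`** (`5 ∉ E'(23)` since `k_23(5) = k_2(5) = 0`; `6 ∈ E'(23)` from
the atom). [cite: BurgisserIkenmeyer2017, Ex. 5.6 and Problem 5.19] -/
theorem genericTensorMinimalDegree_twentyThree_of (h : 0 < kronRect ℂ 13 6) :
    genericTensorMinimalDegree (Fin 23) ℂ = 138 :=
  le_antisymm
    (genericTensorMinimalDegree_le_of_kronRect_pos (by norm_num) (by norm_num)
      (kronRect_twentyThree_six_pos_iff.2 h))
    (le_genericTensorMinimalDegree_sq_sub_two_of_odd (δ := 5) (by norm_num) (by decide))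

/-- The minimal degree is attained: `e(m) = m·δ` for some `δ` with `k_m(δ) > 0` (`m ≥ 1`).
[cite: BurgisserIkenmeyer2017, §5 eq. (5.2)] -/
theorem exists_kronRect_pos_eq_genericTensorMinimalDegree {m : ℕ} (hm : 1 ≤ m) :
    ∃ δ : ℕ, genericTensorMinimalDegree (Fin m) ℂ = m * δ ∧ 0 < kronRect ℂ m δ := by
  unfold genericTensorMinimalDegree
  set S := {d | d ∈ genericTensorDegreeMonoid (Fin m) ℂ ∧ 0 < d}
  have hne : S.Nonempty := by
    refine ⟨m * m, ?_, Nat.mul_pos hm hm⟩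
    rw [genericTensorDegreeMonoid_eq_kronRect m]
    exact ⟨m, rfl, kronRect_self_pos m hm⟩
  have hmem : sInf S ∈ S := Nat.sInf_mem hne
  have h1 : sInf S ∈ {d | ∃ δ : ℕ, d = m * δ ∧ 0 < kronRect ℂ m δ} := by
    rw [← genericTensorDegreeMonoid_eq_kronRect m]
    exact hmem.1
  obtain ⟨δ, hδ, hpos⟩ := h1
  exact ⟨δ, hδ, hpos⟩

/-- **`e(23) = 138 ⟹ k_13(6) > 0`**: the value `138 = 23·6` can only be attained by `δ = 6`.
[cite: BurgisserIkenmeyer2017, Ex. 5.6 and Problem 5.19] -/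
theorem kronRect_thirteen_six_pos_of_minimalDegree (h : genericTensorMinimalDegree (Fin 23) ℂ = 138) :
    0 < kronRect ℂ 13 6 := by
  obtain ⟨δ, hδ, hpos⟩ := exists_kronRect_pos_eq_genericTensorMinimalDegree (m := 23) (by norm_num)
  rw [h] at hδ
  obtain rfl : δ = 6 := by omega
  exact kronRect_twentyThree_six_pos_iff.1 hpos

/-- **`e(23) = 138 ⟺ k_13(6) > 0`.** [cite: BurgisserIkenmeyer2017, Ex. 5.6 and Problem 5.19] -/
theorem genericTensorMinimalDegree_twentyThree_iff :
    genericTensorMinimalDegree (Fin 23) ℂ = 138 ↔ 0 < kronRect ℂ 13 6 :=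
  ⟨kronRect_thirteen_six_pos_of_minimalDegree, genericTensorMinimalDegree_twentyThree_of⟩

/-- **Dichotomy for the anomaly `m = 23`**: either `e(23) = 138` (iff `k_13(6) > 0`) or `e(23) ≥ 161 = 23·7`
(`k_23(δ) = 0` for `δ ≤ 5`). [cite: BurgisserIkenmeyer2017, Ex. 5.6 and Problem 5.19] -/
theorem genericTensorMinimalDegree_twentyThree_eq_or :
    genericTensorMinimalDegree (Fin 23) ℂ = 138 ∨ 161 ≤ genericTensorMinimalDegree (Fin 23) ℂ := by
  by_cases h : 0 < kronRect ℂ 13 6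
  · exact Or.inl (genericTensorMinimalDegree_twentyThree_of h)
  · right
    obtain ⟨δ, hδ, hpos⟩ := exists_kronRect_pos_eq_genericTensorMinimalDegree (m := 23) (by norm_num)
    have h138 : 138 ≤ genericTensorMinimalDegree (Fin 23) ℂ :=
      le_genericTensorMinimalDegree_sq_sub_two_of_odd (δ := 5) (by norm_num) (by decide)
    have h6 : δ ≠ 6 := by
      rintro rfl
      exact h (kronRect_twentyThree_six_pos_iff.1 hpos)
    rw [hδ] at h138 ⊢
    have h7 : 7 ≤ δ := by omega
    calc 161 = 23 * 7 := by norm_num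
      _ ≤ 23 * δ := Nat.mul_le_mul_left 23 h7

/-- `78 ∈ E(13) ⟺ 138 ∈ E(23)` (both say `k_13(6) = k_23(6) > 0`). [cite: BurgisserIkenmeyer2017, §5 eq. (5.2)] -/
theorem mem_genericTensorDegreeMonoid_thirteen_iff_twentyThree :
    78 ∈ genericTensorDegreeMonoid (Fin 13) ℂ ↔ 138 ∈ genericTensorDegreeMonoid (Fin 23) ℂ := by
  rw [genericTensorDegreeMonoid_eq_kronRect 13, genericTensorDegreeMonoid_eq_kronRect 23]
  constructor
  · rintro ⟨δ, hδ, hpos⟩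
    obtain rfl : δ = 6 := by omega
    exact ⟨6, rfl, kronRect_twentyThree_six_pos_iff.2 hpos⟩
  · rintro ⟨δ, hδ, hpos⟩
    obtain rfl : δ = 6 := by omega
    exact ⟨6, rfl, kronRect_twentyThree_six_pos_iff.1 hpos⟩

end Literature.Computability.AlgebraicComplexity

end
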